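import Summits.Ventures.YMGap.RobustBall.RobustStarDoor
import Summits.Ventures.YMGap.RobustBall.TorusRowsSU2
import HarnessLib

/-!
# Venture YMGap, track ROBUST-BALL (Y2) — crux Y2-X2 for the FULL tier-1 ball, step 6: the `SU(2)` ROWS of the
# robust vertex-star door (`d = 4` torus clustering; `d = 3` = Y4's receiving currency)

HONEST FRAMING. WHAT THIS IS: a venture file (cell `pub-ymgap`, track Y2 ROBUST-BALL, seat ds-2): numeric instances
of `RobustStarDoor` for `SU(2)` on the tree's QUARTER one-link modulus `OneLinkKRModulus 2 (3β_W/2) 1` (`β_W ≤ 2/3`,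
`K = 1`, robust coefficient `c ≥ e^{2ε}(1 + 2√2 ε) β_W/4`, `λ ≥ √2 ε`, Neumann depth `20`), on the one-parameter
tier-1 balls `ClusterDomainFR (2ε) ε r` (ANY range `r`, ANY polymers): every row is an exact-rational certificate
`doorPoly d c < 1 ∧ θ < 1 ∧ R_G^{(d)}(c) + (λ + θ^{20}·4dλ)/(1−θ) < 1` (`θ = (2d−2)c + λ`) checked by `norm_num`,
with `e^{2ε}` and `√2` replaced by certified decimal majorants. ROWS (β_W, ε), all HYPOTHESIS-FREE, class K:
`d = 4` (torus clustering `TorusClusteringOnBallUpTo 2 4 (β_W/2) (2ε) ε r A m`, uniform in `L ≥ 3` and in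
`0 ≤ β ≤ β_W/2`): (1/8, .148) (1/6, .112) (1/5, .087) (1/4, .055) (3/10, .028) (1/3, .012) — the single-link
quarter door of `TorusRowsSU2` stops at `β_W < 2/9` ((1/8, .130) (1/6, .062) (1/5, .022)); `d = 3` (Y4's
`YM3IR.ClusterDomainClustering` on `ClusterDomainFR (2ε) ε r` up to `β_W/2`): (1/4, .114) (3/10, .090) (2/5, .050)
(1/2, .017) — row 2e of the cell's table had (1/4, .06) (3/10, .02). WHAT THIS IS NOT: the radii are artefacts of
the door (they vanish linearly at the star threshold `β_W = 0.3609` for `d = 4`, `0.561` for `d = 3`); nothing about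
the continuum limit or the Millennium problem.

## References
* The tree: `RobustStarDoor.lean` (this seat), `TorusRowsSU2.lean` (`sqrt_two_le`, the quarter-modulus pattern),
  `Thresholds/QuarterModulusTwoThirds.lean`, `Thresholds/StarResolventDim.lean` (`gaugeR`, `doorPoly`).
-/

noncomputable section

open Finset
open Literature.MathematicalPhysics.QuantumLattice (fundamentalRep)
open Literature.MathematicalPhysics.QuantumFieldTheory hiding ZdEdge
open Literature.MathematicalPhysics.QuantumFieldTheory.Balaban1983to89.StrongCouplingTorusWindow
open Literature.MathematicalPhysics.QuantumFieldTheory.Balaban1983to89.StrongCouplingDobrushinWindow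
  (OneLinkKRModulus OneLinkKRModulusSU2)
open Summit.Ventures.YMGap.StarResolventDim (Delta gaugeR doorPoly Delta_pos_of_door gaugeR_lt_one_of_door)

namespace Summit.Ventures.YMGap.RobustBall

/-! ### Certified decimal majorants of `e^{2ε}` -/

/-- `e^{37 / 125} ≤ 1344473 / 1000000` (Mathlib's `Real.exp_bound'`, five terms). [folklore] -/
theorem exp_le_37_125_star : Real.exp (37 / 125) ≤ 1344473 / 1000000 := by
  have h := Real.exp_bound' (x := 37 / 125) (by norm_num) (by norm_num) (n := 5) (by norm_num)
  refine h.trans ?_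
  simp only [Finset.sum_range_succ, Finset.sum_range_zero, Nat.factorial]
  norm_num

/-- `e^{28 / 125} ≤ 19548 / 15625` (Mathlib's `Real.exp_bound'`, five terms). [folklore] -/
theorem exp_le_28_125_star : Real.exp (28 / 125) ≤ 19548 / 15625 := by
  have h := Real.exp_bound' (x := 28 / 125) (by norm_num) (by norm_num) (n := 5) (by norm_num)
  refine h.trans ?_
  simp only [Finset.sum_range_succ, Finset.sum_range_zero, Nat.factorial]
  norm_num

/-- `e^{87 / 500} ≤ 148757 / 125000` (Mathlib's `Real.exp_bound'`, five terms). [folklore] -/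
theorem exp_le_87_500_star : Real.exp (87 / 500) ≤ 148757 / 125000 := by
  have h := Real.exp_bound' (x := 87 / 500) (by norm_num) (by norm_num) (n := 5) (by norm_num)
  refine h.trans ?_
  simp only [Finset.sum_range_succ, Finset.sum_range_zero, Nat.factorial]
  norm_num

/-- `e^{11 / 100} ≤ 1116279 / 1000000` (Mathlib's `Real.exp_bound'`, five terms). [folklore] -/
theorem exp_le_11_100_star : Real.exp (11 / 100) ≤ 1116279 / 1000000 := by
  have h := Real.exp_bound' (x := 11 / 100) (by norm_num) (by norm_num) (n := 5) (by norm_num)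
  refine h.trans ?_
  simp only [Finset.sum_range_succ, Finset.sum_range_zero, Nat.factorial]
  norm_num

/-- `e^{7 / 125} ≤ 528799 / 500000` (Mathlib's `Real.exp_bound'`, five terms). [folklore] -/
theorem exp_le_7_125_star : Real.exp (7 / 125) ≤ 528799 / 500000 := by
  have h := Real.exp_bound' (x := 7 / 125) (by norm_num) (by norm_num) (n := 5) (by norm_num)
  refine h.trans ?_
  simp only [Finset.sum_range_succ, Finset.sum_range_zero, Nat.factorial]
  norm_num

/-- `e^{3 / 125} ≤ 1024291 / 1000000` (Mathlib's `Real.exp_bound'`, five terms). [folklore] -/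
theorem exp_le_3_125_star : Real.exp (3 / 125) ≤ 1024291 / 1000000 := by
  have h := Real.exp_bound' (x := 3 / 125) (by norm_num) (by norm_num) (n := 5) (by norm_num)
  refine h.trans ?_
  simp only [Finset.sum_range_succ, Finset.sum_range_zero, Nat.factorial]
  norm_num

/-- `e^{57 / 250} ≤ 1256087 / 1000000` (Mathlib's `Real.exp_bound'`, five terms). [folklore] -/
theorem exp_le_57_250_star : Real.exp (57 / 250) ≤ 1256087 / 1000000 := by
  have h := Real.exp_bound' (x := 57 / 250) (by norm_num) (by norm_num) (n := 5) (by norm_num)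
  refine h.trans ?_
  simp only [Finset.sum_range_succ, Finset.sum_range_zero, Nat.factorial]
  norm_num

/-- `e^{9 / 50} ≤ 598609 / 500000` (Mathlib's `Real.exp_bound'`, five terms). [folklore] -/
theorem exp_le_9_50_star : Real.exp (9 / 50) ≤ 598609 / 500000 := by
  have h := Real.exp_bound' (x := 9 / 50) (by norm_num) (by norm_num) (n := 5) (by norm_num)
  refine h.trans ?_
  simp only [Finset.sum_range_succ, Finset.sum_range_zero, Nat.factorial]
  norm_num

/-- `e^{1 / 10} ≤ 1105171 / 1000000` (Mathlib's `Real.exp_bound'`, five terms). [folklore] -/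
theorem exp_le_1_10_star : Real.exp (1 / 10) ≤ 1105171 / 1000000 := by
  have h := Real.exp_bound' (x := 1 / 10) (by norm_num) (by norm_num) (n := 5) (by norm_num)
  refine h.trans ?_
  simp only [Finset.sum_range_succ, Finset.sum_range_zero, Nat.factorial]
  norm_num

/-- `e^{17 / 500} ≤ 206917 / 200000` (Mathlib's `Real.exp_bound'`, five terms). [folklore] -/
theorem exp_le_17_500_star : Real.exp (17 / 500) ≤ 206917 / 200000 := by
  have h := Real.exp_bound' (x := 17 / 500) (by norm_num) (by norm_num) (n := 5) (by norm_num)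
  refine h.trans ?_
  simp only [Finset.sum_range_succ, Finset.sum_range_zero, Nat.factorial]
  norm_num


/-! ### The schemas: `SU(2)` on the quarter modulus through the robust star door -/

/-- The tree's quarter modulus in the binder shape used here. [folklore] -/
theorem su2_quarterModulus {βW : ℝ} (hβ : βW ≤ 2 / 3) : OneLinkKRModulus 2 (3 * βW / 2) 1 := by
  have h := QuarterModulusTwoThirds.oneLinkKRModulusSU2_of_le_twoThirds hβ
  unfold OneLinkKRModulusSU2 at h
  norm_num at h
  exact h

/-- **SCHEMA, `SU(2)`, `d = 4`: torus clustering on the whole tier-1 ball `ClusterDomainFR ε₀ ε₁ r` through the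
ROBUST STAR DOOR**, uniformly in `L ≥ 3` and in the tree coupling `0 ≤ β ≤ β_W/2` (`0 < β_W ≤ 2/3`): given decimal
majorants `e^{ε₀} ≤ E`, `√2 ≤ S`, a coefficient `c ≥ E(1 + 2Sε₁)β_W/4`, `λ ≥ Sε₁`, and the three rational
inequalities `doorPoly 4 c < 1`, `6c + λ < 1`, `gaugeR 4 c + (λ + (6c+λ)^K·16λ)/(1 − (6c+λ)) < 1`, there are
`A` and `m > 0` (explicit in `RobustStarDoor`) with `TorusClusteringOnBallUpTo 2 4 (β_W/2) ε₀ ε₁ r A m`. [folklore] -/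
theorem su2_torusClusteringOnBallUpTo_star (Kn : ℕ) {βW ε₀ ε₁ c lam E S : ℝ} (hβ0 : 0 < βW) (hβ : βW ≤ 2 / 3)
    (hε₁ : 0 ≤ ε₁) (hE : Real.exp ε₀ ≤ E) (hS : Real.sqrt 2 ≤ S) (hc : E * (1 + 2 * S * ε₁) * (βW / 4) ≤ c)
    (hlam : S * ε₁ ≤ lam) (hθ1 : 6 * c + lam < 1) (hcd : doorPoly 4 c < 1)
    (hρ1 : gaugeR 4 c + (lam + (6 * c + lam) ^ Kn * (16 * lam)) / (1 - (6 * c + lam)) < 1) (r : ℕ) :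
    ∃ A m : ℝ, 0 < m ∧ TorusClusteringOnBallUpTo 2 4 (βW / 2) ε₀ ε₁ r A m := by
  have hS0 : 0 ≤ S := (Real.sqrt_nonneg _).trans hS
  have hE0 : 0 ≤ E := (Real.exp_pos _).le.trans hE
  have hc0 : 0 ≤ c := le_trans (by positivity) hc
  have hlam0 : 0 ≤ lam := le_trans (by positivity) hlam
  set θ : ℝ := 6 * c + lam with hθ
  set ρ : ℝ := gaugeR 4 c + (lam + θ ^ Kn * (16 * lam)) / (1 - θ) with hρ
  have hθ0 : 0 ≤ θ := by positivity
  have hgR := gaugeR_lt_one_of_door (d := 4) (by norm_num) hc0 hcd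
  have hρ0 : 0 ≤ ρ := by
    have : 0 ≤ θ ^ Kn := pow_nonneg hθ0 Kn
    have h1 : 0 < 1 - θ := by linarith
    rw [hρ]; exact add_nonneg hgR.1 (div_nonneg (by positivity) h1.le)
  have hR : βW / 2 / ((2 : ℕ) : ℝ) * (2 * (((4 : ℕ) : ℝ) - 1)) ≤ 3 * βW / 2 := by push_cast; linarith
  have hc' : (1 : ℝ) * Real.exp ε₀ * (1 + 2 * Real.sqrt ((2 : ℕ) : ℝ) * ε₁) * (βW / 2 / ((2 : ℕ) : ℝ)) ≤ c := by
    refine le_trans ?_ hc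
    have h1 : Real.sqrt ((2 : ℕ) : ℝ) = Real.sqrt 2 := by norm_num
    rw [h1, one_mul]
    have h2 : 1 + 2 * Real.sqrt 2 * ε₁ ≤ 1 + 2 * S * ε₁ := by nlinarith
    have h3 : 0 ≤ 1 + 2 * Real.sqrt 2 * ε₁ := by positivity
    have h4 : βW / 2 / ((2 : ℕ) : ℝ) = βW / 4 := by push_cast; ring
    rw [h4]
    have hb : 0 ≤ βW / 4 := by positivity
    calc Real.exp ε₀ * (1 + 2 * Real.sqrt 2 * ε₁) * (βW / 4) ≤ E * (1 + 2 * Real.sqrt 2 * ε₁) * (βW / 4) := by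
          gcongr
      _ ≤ E * (1 + 2 * S * ε₁) * (βW / 4) := by gcongr
  have hlam' : Real.sqrt ((2 : ℕ) : ℝ) * ε₁ ≤ lam := by
    have h1 : Real.sqrt ((2 : ℕ) : ℝ) = Real.sqrt 2 := by norm_num
    rw [h1]; exact le_trans (mul_le_mul_of_nonneg_right hS hε₁) hlam
  have hθ' : θ = (2 * ((4 : ℕ) : ℝ) - 2) * c + lam := by rw [hθ]; push_cast; ring
  have hρ' : ρ = gaugeR 4 c + (lam + θ ^ Kn * (4 * ((4 : ℕ) : ℝ) * lam)) / (1 - θ) := by rw [hρ]; push_cast; ring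
  have h := torusClusteringOnBallUpTo_of_robustStar (d := 4) (N := 2) (by norm_num) (by norm_num) r Kn zero_le_one
    hR (su2_quarterModulus hβ) hε₁ hc' hlam' hθ' hθ1 hcd hρ' hρ1
  refine ⟨_, _, ?_, h⟩
  have h1 : 0 < 1 - ρ := by linarith
  have hden : 0 < 2 * (2 * ρ * ((2 * 4 : ℕ) : ℝ) + 1) := by push_cast; nlinarith
  positivity

/-- **SCHEMA, `SU(2)`, `d = 3`: Y4's receiving currency `YM3IR.ClusterDomainClustering` on the whole tier-1 ball
`ClusterDomainFR ε₀ ε₁ r` up to `β_W/2` through the ROBUST STAR DOOR** (`0 < β_W ≤ 2/3`; door polynomial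
`8c² + 6c < 1`, `θ = 4c + λ`, `gaugeR 3 c + (λ + θ^K·12λ)/(1−θ) < 1`); also the torus form `UpTo`. [folklore] -/
theorem su2_clusterDomainClustering_dim3_star (Kn : ℕ) {βW ε₀ ε₁ c lam E S : ℝ} (hβ0 : 0 < βW) (hβ : βW ≤ 2 / 3)
    (hε₁ : 0 ≤ ε₁) (hE : Real.exp ε₀ ≤ E) (hS : Real.sqrt 2 ≤ S) (hc : E * (1 + 2 * S * ε₁) * (βW / 4) ≤ c)
    (hlam : S * ε₁ ≤ lam) (hθ1 : 4 * c + lam < 1) (hcd : doorPoly 3 c < 1)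
    (hρ1 : gaugeR 3 c + (lam + (4 * c + lam) ^ Kn * (12 * lam)) / (1 - (4 * c + lam)) < 1) (r : ℕ) :
    ∃ m : ℝ, 0 < m ∧
      YM3IR.ClusterDomainClustering (G := SUN 2)
        ⟨fundamentalRep (Fin 2), βW / 2, fun _ _ W => W ∈ ClusterDomainFR ε₀ ε₁ r⟩ suFrobDist m ∧
      ∃ A : ℝ, TorusClusteringOnBallUpTo 2 3 (βW / 2) ε₀ ε₁ r A m := by
  have hS0 : 0 ≤ S := (Real.sqrt_nonneg _).trans hS
  have hE0 : 0 ≤ E := (Real.exp_pos _).le.trans hE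
  have hc0 : 0 ≤ c := le_trans (by positivity) hc
  have hlam0 : 0 ≤ lam := le_trans (by positivity) hlam
  set θ : ℝ := 4 * c + lam with hθ
  set ρ : ℝ := gaugeR 3 c + (lam + θ ^ Kn * (12 * lam)) / (1 - θ) with hρ
  have hθ0 : 0 ≤ θ := by positivity
  have hgR := gaugeR_lt_one_of_door (d := 3) (by norm_num) hc0 hcd
  have hρ0 : 0 ≤ ρ := by
    have : 0 ≤ θ ^ Kn := pow_nonneg hθ0 Kn
    have h1 : 0 < 1 - θ := by linarith
    rw [hρ]; exact add_nonneg hgR.1 (div_nonneg (by positivity) h1.le)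
  have hR : βW / 2 / ((2 : ℕ) : ℝ) * 4 ≤ 3 * βW / 2 := by push_cast; linarith
  have hR' : βW / 2 / ((2 : ℕ) : ℝ) * (2 * (((3 : ℕ) : ℝ) - 1)) ≤ 3 * βW / 2 := by push_cast; linarith
  have hc' : (1 : ℝ) * Real.exp ε₀ * (1 + 2 * Real.sqrt ((2 : ℕ) : ℝ) * ε₁) * (βW / 2 / ((2 : ℕ) : ℝ)) ≤ c := by
    refine le_trans ?_ hc
    have h1 : Real.sqrt ((2 : ℕ) : ℝ) = Real.sqrt 2 := by norm_num
    rw [h1, one_mul]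
    have h2 : 1 + 2 * Real.sqrt 2 * ε₁ ≤ 1 + 2 * S * ε₁ := by nlinarith
    have h3 : 0 ≤ 1 + 2 * Real.sqrt 2 * ε₁ := by positivity
    have h4 : βW / 2 / ((2 : ℕ) : ℝ) = βW / 4 := by push_cast; ring
    rw [h4]
    have hb : 0 ≤ βW / 4 := by positivity
    calc Real.exp ε₀ * (1 + 2 * Real.sqrt 2 * ε₁) * (βW / 4) ≤ E * (1 + 2 * Real.sqrt 2 * ε₁) * (βW / 4) := by
          gcongr
      _ ≤ E * (1 + 2 * S * ε₁) * (βW / 4) := by gcongr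
  have hlam' : Real.sqrt ((2 : ℕ) : ℝ) * ε₁ ≤ lam := by
    have h1 : Real.sqrt ((2 : ℕ) : ℝ) = Real.sqrt 2 := by norm_num
    rw [h1]; exact le_trans (mul_le_mul_of_nonneg_right hS hε₁) hlam
  have hθ' : θ = (2 * ((3 : ℕ) : ℝ) - 2) * c + lam := by rw [hθ]; push_cast; ring
  have hρ' : ρ = gaugeR 3 c + (lam + θ ^ Kn * (4 * ((3 : ℕ) : ℝ) * lam)) / (1 - θ) := by rw [hρ]; push_cast; ring
  have hm : 0 < (1 - ρ) ^ 2 / (2 * (2 * ρ * ((2 * 3 : ℕ) : ℝ) + 1)) / ((max r 1 + 2 : ℕ) : ℝ) := by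
    have h1 : 0 < 1 - ρ := by linarith
    have hden : 0 < 2 * (2 * ρ * ((2 * 3 : ℕ) : ℝ) + 1) := by push_cast; nlinarith
    positivity
  refine ⟨_, hm, clusterDomainClustering_dim3_of_robustStar (N := 2) (by norm_num) r Kn zero_le_one hR
    (su2_quarterModulus hβ) hε₁ hc' hlam' hθ hθ1 hcd hρ hρ1, _,
    torusClusteringOnBallUpTo_of_robustStar (d := 3) (N := 2) (by norm_num) (by norm_num) r Kn zero_le_one hR'
      (su2_quarterModulus hβ) hε₁ hc' hlam' hθ' hθ1 hcd hρ' hρ1⟩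

/-! ### The `d = 4` rows (torus clustering on the whole tier-1 ball, star door) -/

/-- **ROW `(β_W, ε) = (1 / 8, 37 / 250)`, `SU(2)`, `d = 4`, ROBUST STAR DOOR** — every member of the tier-1 ball
`ClusterDomainFR (37 / 125) (37 / 250) r` (any range `r`, any polymers) clusters exponentially on every torus
`(ℤ/L)⁴`, `L ≥ 3`, at every tree coupling `0 ≤ β ≤ 1 / 16`, with constants depending on the row and `r` only
(certificate: `c = 59603 / 1000000`, `λ = 41861 / 200000`, `ρ ≈ 0.9953`); HYPOTHESIS-FREE. [folklore] -/
theorem su2_torusClusteringOnBallUpTo_star_oneEighth (r : ℕ) :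
    ∃ A m : ℝ, 0 < m ∧ TorusClusteringOnBallUpTo 2 4 (1 / 16) (37 / 125) (37 / 250) r A m := by
  have e1 : (1 / 8 : ℝ) / 2 = 1 / 16 := by norm_num
  have h := su2_torusClusteringOnBallUpTo_star 20 (βW := 1 / 8) (ε₀ := 37 / 125) (ε₁ := 37 / 250)
    (c := 59603 / 1000000) (lam := 41861 / 200000) (by norm_num) (by norm_num) (by norm_num) exp_le_37_125_star sqrt_two_le
    (by norm_num) (by norm_num) (by norm_num) (by unfold doorPoly; norm_num)
    (by unfold gaugeR Delta; norm_num) r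
  rw [e1] at h
  exact h

/-- **ROW `(β_W, ε) = (1 / 6, 14 / 125)`, `SU(2)`, `d = 4`, ROBUST STAR DOOR** — every member of the tier-1 ball
`ClusterDomainFR (28 / 125) (14 / 125) r` (any range `r`, any polymers) clusters exponentially on every torus
`(ℤ/L)⁴`, `L ≥ 3`, at every tree coupling `0 ≤ β ≤ 1 / 12`, with constants depending on the row and `r` only
(certificate: `c = 34321 / 500000`, `λ = 158393 / 1000000`, `ρ ≈ 0.9999`); HYPOTHESIS-FREE. [folklore] -/
theorem su2_torusClusteringOnBallUpTo_star_oneSixth (r : ℕ) :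
    ∃ A m : ℝ, 0 < m ∧ TorusClusteringOnBallUpTo 2 4 (1 / 12) (28 / 125) (14 / 125) r A m := by
  have e1 : (1 / 6 : ℝ) / 2 = 1 / 12 := by norm_num
  have h := su2_torusClusteringOnBallUpTo_star 20 (βW := 1 / 6) (ε₀ := 28 / 125) (ε₁ := 14 / 125)
    (c := 34321 / 500000) (lam := 158393 / 1000000) (by norm_num) (by norm_num) (by norm_num) exp_le_28_125_star sqrt_two_le
    (by norm_num) (by norm_num) (by norm_num) (by unfold doorPoly; norm_num)
    (by unfold gaugeR Delta; norm_num) r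
  rw [e1] at h
  exact h

/-- **ROW `(β_W, ε) = (1 / 5, 87 / 1000)`, `SU(2)`, `d = 4`, ROBUST STAR DOOR** — every member of the tier-1 ball
`ClusterDomainFR (87 / 500) (87 / 1000) r` (any range `r`, any polymers) clusters exponentially on every torus
`(ℤ/L)⁴`, `L ≥ 3`, at every tree coupling `0 ≤ β ≤ 1 / 10`, with constants depending on the row and `r` only
(certificate: `c = 14829 / 200000`, `λ = 61519 / 500000`, `ρ ≈ 0.9976`); HYPOTHESIS-FREE. [folklore] -/
theorem su2_torusClusteringOnBallUpTo_star_oneFifth (r : ℕ) :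
    ∃ A m : ℝ, 0 < m ∧ TorusClusteringOnBallUpTo 2 4 (1 / 10) (87 / 500) (87 / 1000) r A m := by
  have e1 : (1 / 5 : ℝ) / 2 = 1 / 10 := by norm_num
  have h := su2_torusClusteringOnBallUpTo_star 20 (βW := 1 / 5) (ε₀ := 87 / 500) (ε₁ := 87 / 1000)
    (c := 14829 / 200000) (lam := 61519 / 500000) (by norm_num) (by norm_num) (by norm_num) exp_le_87_500_star sqrt_two_le
    (by norm_num) (by norm_num) (by norm_num) (by unfold doorPoly; norm_num)
    (by unfold gaugeR Delta; norm_num) r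
  rw [e1] at h
  exact h

/-- **ROW `(β_W, ε) = (1 / 4, 11 / 200)`, `SU(2)`, `d = 4`, ROBUST STAR DOOR** — every member of the tier-1 ball
`ClusterDomainFR (11 / 100) (11 / 200) r` (any range `r`, any polymers) clusters exponentially on every torus
`(ℤ/L)⁴`, `L ≥ 3`, at every tree coupling `0 ≤ β ≤ 1 / 8`, with constants depending on the row and `r` only
(certificate: `c = 80621 / 1000000`, `λ = 77783 / 1000000`, `ρ ≈ 0.9961`); HYPOTHESIS-FREE. [folklore] -/
theorem su2_torusClusteringOnBallUpTo_star_oneQuarter (r : ℕ) :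
    ∃ A m : ℝ, 0 < m ∧ TorusClusteringOnBallUpTo 2 4 (1 / 8) (11 / 100) (11 / 200) r A m := by
  have e1 : (1 / 4 : ℝ) / 2 = 1 / 8 := by norm_num
  have h := su2_torusClusteringOnBallUpTo_star 20 (βW := 1 / 4) (ε₀ := 11 / 100) (ε₁ := 11 / 200)
    (c := 80621 / 1000000) (lam := 77783 / 1000000) (by norm_num) (by norm_num) (by norm_num) exp_le_11_100_star sqrt_two_le
    (by norm_num) (by norm_num) (by norm_num) (by unfold doorPoly; norm_num)
    (by unfold gaugeR Delta; norm_num) r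
  rw [e1] at h
  exact h

/-- **ROW `(β_W, ε) = (3 / 10, 7 / 250)`, `SU(2)`, `d = 4`, ROBUST STAR DOOR** — every member of the tier-1 ball
`ClusterDomainFR (7 / 125) (7 / 250) r` (any range `r`, any polymers) clusters exponentially on every torus
`(ℤ/L)⁴`, `L ≥ 3`, at every tree coupling `0 ≤ β ≤ 3 / 20`, with constants depending on the row and `r` only
(certificate: `c = 42801 / 500000`, `λ = 39599 / 1000000`, `ρ ≈ 0.9973`); HYPOTHESIS-FREE. [folklore] -/
theorem su2_torusClusteringOnBallUpTo_star_threeTenths (r : ℕ) :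
    ∃ A m : ℝ, 0 < m ∧ TorusClusteringOnBallUpTo 2 4 (3 / 20) (7 / 125) (7 / 250) r A m := by
  have e1 : (3 / 10 : ℝ) / 2 = 3 / 20 := by norm_num
  have h := su2_torusClusteringOnBallUpTo_star 20 (βW := 3 / 10) (ε₀ := 7 / 125) (ε₁ := 7 / 250)
    (c := 42801 / 500000) (lam := 39599 / 1000000) (by norm_num) (by norm_num) (by norm_num) exp_le_7_125_star sqrt_two_le
    (by norm_num) (by norm_num) (by norm_num) (by unfold doorPoly; norm_num)
    (by unfold gaugeR Delta; norm_num) r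
  rw [e1] at h
  exact h

/-- **ROW `(β_W, ε) = (1 / 3, 3 / 250)`, `SU(2)`, `d = 4`, ROBUST STAR DOOR** — every member of the tier-1 ball
`ClusterDomainFR (3 / 125) (3 / 250) r` (any range `r`, any polymers) clusters exponentially on every torus
`(ℤ/L)⁴`, `L ≥ 3`, at every tree coupling `0 ≤ β ≤ 1 / 6`, with constants depending on the row and `r` only
(certificate: `c = 17651 / 200000`, `λ = 16971 / 1000000`, `ρ ≈ 0.9975`); HYPOTHESIS-FREE. [folklore] -/
theorem su2_torusClusteringOnBallUpTo_star_oneThird (r : ℕ) :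
    ∃ A m : ℝ, 0 < m ∧ TorusClusteringOnBallUpTo 2 4 (1 / 6) (3 / 125) (3 / 250) r A m := by
  have e1 : (1 / 3 : ℝ) / 2 = 1 / 6 := by norm_num
  have h := su2_torusClusteringOnBallUpTo_star 20 (βW := 1 / 3) (ε₀ := 3 / 125) (ε₁ := 3 / 250)
    (c := 17651 / 200000) (lam := 16971 / 1000000) (by norm_num) (by norm_num) (by norm_num) exp_le_3_125_star sqrt_two_le
    (by norm_num) (by norm_num) (by norm_num) (by unfold doorPoly; norm_num)
    (by unfold gaugeR Delta; norm_num) r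
  rw [e1] at h
  exact h

/-! ### The `d = 3` rows (Y4's receiving currency `ClusterDomainClustering`, star door) -/

/-- **ROW `(β_W, ε) = (1 / 4, 57 / 500)`, `SU(2)`, `d = 3`, ROBUST STAR DOOR** — Y4's receiving currency
`YM3IR.ClusterDomainClustering` on the tier-1 ball `ClusterDomainFR (57 / 250) (57 / 500) r` up to tree coupling
`1 / 8` (Wilson `β_W = 1 / 4`), with a positive rate depending on the row and `r` only, plus the torus form
(certificate: `c = 103819 / 1000000`, `λ = 80611 / 500000`, `ρ ≈ 0.9926`); HYPOTHESIS-FREE. [folklore] -/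
theorem su2_clusterDomainClustering_dim3_star_oneQuarter (r : ℕ) :
    ∃ m : ℝ, 0 < m ∧
      YM3IR.ClusterDomainClustering (G := SUN 2)
        ⟨fundamentalRep (Fin 2), 1 / 8, fun _ _ W => W ∈ ClusterDomainFR (57 / 250) (57 / 500) r⟩ suFrobDist m ∧
      ∃ A : ℝ, TorusClusteringOnBallUpTo 2 3 (1 / 8) (57 / 250) (57 / 500) r A m := by
  have e1 : (1 / 4 : ℝ) / 2 = 1 / 8 := by norm_num
  have h := su2_clusterDomainClustering_dim3_star 20 (βW := 1 / 4) (ε₀ := 57 / 250) (ε₁ := 57 / 500)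
    (c := 103819 / 1000000) (lam := 80611 / 500000) (by norm_num) (by norm_num) (by norm_num) exp_le_57_250_star sqrt_two_le
    (by norm_num) (by norm_num) (by norm_num) (by unfold doorPoly; norm_num)
    (by unfold gaugeR Delta; norm_num) r
  rw [e1] at h
  exact h

/-- **ROW `(β_W, ε) = (3 / 10, 9 / 100)`, `SU(2)`, `d = 3`, ROBUST STAR DOOR** — Y4's receiving currency
`YM3IR.ClusterDomainClustering` on the tier-1 ball `ClusterDomainFR (9 / 50) (9 / 100) r` up to tree coupling
`3 / 20` (Wilson `β_W = 3 / 10`), with a positive rate depending on the row and `r` only, plus the torus form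
(certificate: `c = 112649 / 1000000`, `λ = 1591 / 12500`, `ρ ≈ 0.9941`); HYPOTHESIS-FREE. [folklore] -/
theorem su2_clusterDomainClustering_dim3_star_threeTenths (r : ℕ) :
    ∃ m : ℝ, 0 < m ∧
      YM3IR.ClusterDomainClustering (G := SUN 2)
        ⟨fundamentalRep (Fin 2), 3 / 20, fun _ _ W => W ∈ ClusterDomainFR (9 / 50) (9 / 100) r⟩ suFrobDist m ∧
      ∃ A : ℝ, TorusClusteringOnBallUpTo 2 3 (3 / 20) (9 / 50) (9 / 100) r A m := by
  have e1 : (3 / 10 : ℝ) / 2 = 3 / 20 := by norm_num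
  have h := su2_clusterDomainClustering_dim3_star 20 (βW := 3 / 10) (ε₀ := 9 / 50) (ε₁ := 9 / 100)
    (c := 112649 / 1000000) (lam := 1591 / 12500) (by norm_num) (by norm_num) (by norm_num) exp_le_9_50_star sqrt_two_le
    (by norm_num) (by norm_num) (by norm_num) (by unfold doorPoly; norm_num)
    (by unfold gaugeR Delta; norm_num) r
  rw [e1] at h
  exact h

/-- **ROW `(β_W, ε) = (2 / 5, 1 / 20)`, `SU(2)`, `d = 3`, ROBUST STAR DOOR** — Y4's receiving currency
`YM3IR.ClusterDomainClustering` on the tier-1 ball `ClusterDomainFR (1 / 10) (1 / 20) r` up to tree coupling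
`1 / 5` (Wilson `β_W = 2 / 5`), with a positive rate depending on the row and `r` only, plus the torus form
(certificate: `c = 126147 / 1000000`, `λ = 70711 / 1000000`, `ρ ≈ 0.9972`); HYPOTHESIS-FREE. [folklore] -/
theorem su2_clusterDomainClustering_dim3_star_twoFifths (r : ℕ) :
    ∃ m : ℝ, 0 < m ∧
      YM3IR.ClusterDomainClustering (G := SUN 2)
        ⟨fundamentalRep (Fin 2), 1 / 5, fun _ _ W => W ∈ ClusterDomainFR (1 / 10) (1 / 20) r⟩ suFrobDist m ∧
      ∃ A : ℝ, TorusClusteringOnBallUpTo 2 3 (1 / 5) (1 / 10) (1 / 20) r A m := by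
  have e1 : (2 / 5 : ℝ) / 2 = 1 / 5 := by norm_num
  have h := su2_clusterDomainClustering_dim3_star 20 (βW := 2 / 5) (ε₀ := 1 / 10) (ε₁ := 1 / 20)
    (c := 126147 / 1000000) (lam := 70711 / 1000000) (by norm_num) (by norm_num) (by norm_num) exp_le_1_10_star sqrt_two_le
    (by norm_num) (by norm_num) (by norm_num) (by unfold doorPoly; norm_num)
    (by unfold gaugeR Delta; norm_num) r
  rw [e1] at h
  exact h

/-- **ROW `(β_W, ε) = (1 / 2, 17 / 1000)`, `SU(2)`, `d = 3`, ROBUST STAR DOOR** — Y4's receiving currency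
`YM3IR.ClusterDomainClustering` on the tier-1 ball `ClusterDomainFR (17 / 500) (17 / 1000) r` up to tree coupling
`1 / 4` (Wilson `β_W = 1 / 2`), with a positive rate depending on the row and `r` only, plus the torus form
(certificate: `c = 67771 / 500000`, `λ = 12021 / 500000`, `ρ ≈ 0.9947`); HYPOTHESIS-FREE. [folklore] -/
theorem su2_clusterDomainClustering_dim3_star_oneHalf (r : ℕ) :
    ∃ m : ℝ, 0 < m ∧
      YM3IR.ClusterDomainClustering (G := SUN 2)
        ⟨fundamentalRep (Fin 2), 1 / 4, fun _ _ W => W ∈ ClusterDomainFR (17 / 500) (17 / 1000) r⟩ suFrobDist m ∧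
      ∃ A : ℝ, TorusClusteringOnBallUpTo 2 3 (1 / 4) (17 / 500) (17 / 1000) r A m := by
  have e1 : (1 / 2 : ℝ) / 2 = 1 / 4 := by norm_num
  have h := su2_clusterDomainClustering_dim3_star 20 (βW := 1 / 2) (ε₀ := 17 / 500) (ε₁ := 17 / 1000)
    (c := 67771 / 500000) (lam := 12021 / 500000) (by norm_num) (by norm_num) (by norm_num) exp_le_17_500_star sqrt_two_le
    (by norm_num) (by norm_num) (by norm_num) (by unfold doorPoly; norm_num)
    (by unfold gaugeR Delta; norm_num) r
  rw [e1] at h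
  exact h

end Summit.Ventures.YMGap.RobustBall

end
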